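import Literature.AlgebraicGeometry.Motives.HodgeStructureCentralizerRestrictionToRepresentatives
import Literature.AlgebraicGeometry.Motives.HodgeStructureCentralizerHomIsomorphismTransport
import HarnessLib

/-!
# «THE DIAGONAL ACTION OF `C(A)` ON `rV(A)` IDENTIFIES `C(A)` WITH `C(A^r)`» WITH ITS FORMULA, and THE CANONICAL BLOCK `C(S) ⥲ C(U)`
# BY RESTRICTION: for an internal direct sum `V' = ⊕ᵢ Tᵢ` of sub-Hodge structures with isomorphisms `rᵢ : H₀ ⥲ Tᵢ` the
# isomorphism `C(H₀) ≃ₐ[ℚ] C(H')` IS the diagonal action `(e γ₀)(rᵢ x) = rᵢ (γ₀ x)` (unique, and of algebras with involution for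
# ANY polarizations); for a minimal `E_φ`-stable sub-Hodge structure `S ⊇ U` irreducible of a polarizable `H`, RESTRICTION TO `U`
# is an isomorphism of algebras with involution `(C(S), †_{ψ|S}) ≃ₐ (C(U), †_{ψ|U})` (Milne 1999 §1 p. 643 L12–L13, Prop. 1.1)

[topic AlgebraicGeometry/Motives]

Layer `Literature/AlgebraicGeometry/Motives`, lane `lit-hodgefound` (Track 2 foundations library; prover seat
`lit-hodgefound-p02`, generation 53, self-proposed row g53-#3). THEOREMS ONLY: no definition, no named fact (net debt `0`),
no instance, no notation.  Sequel, BY NAME (nothing restated), of g52-#5 `Motives/HodgeStructureCentralizerIsotypicBlock`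
(`bijective_piDesc_subtypeHom_comp_toLinearMap`: `(xᵢ) ↦ Σ rᵢ xᵢ` is a Hodge isomorphism `H₀^{⊕ι} ⥲ H'`;
`nonempty_centralizer_endAlg_algEquiv_of_isInternal_of_forall_bijective`, `nonempty_centralizer_endAlg_algEquiv_of_minimal_stable`:
the isomorphisms `C(H') ≃ₐ C(H₀)`, `C(S) ≃ₐ C(U)` as bare `Nonempty`), p34's `centralizerPiConstAlgEquiv` (`C(H₀) ≃ₐ C(H₀^{⊕ι})`,
`γ₀ ↦ diag(γ₀,…,γ₀)`) and `Polarization.adjoint_pi_piDiag` (`Motives/HodgeStructureLefschetzGroupFiniteDirectSum`), g52-#8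
`Motives/HodgeStructureCentralizerHomIsomorphismTransport` (`C(H₁) ≃ₐ C(H₂)` OVER a Hodge isomorphism, with `†`), g53-#1
`Motives/HodgeStructureCentralizerRestrictionToRepresentatives` (for polarizable `H`, `γ ∈ C(H)` preserves every sub-Hodge structure
and commutes with every morphism out of it) and g52-#1 `toSubmodule_eq_isotypicComponent_of_minimal_stable` (`S = ⨆{U' ≅ U}`).
Here the two `Nonempty` isomorphisms of g52-#5 get their FORMULAS: the first is the diagonal action, the second is restriction.

## The source, verbatim

J. S. Milne, *Lefschetz classes on abelian varieties*, Duke Math. J. 96 (1999) 639–675 [Milne1999LefschetzClasses] (held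
`paper:doi-10-1215-s0012-7094-99-09620-5`, p. 643 L7–L13): "An isogeny `α : A → B` defines an isomorphism
`γ ↦ V(α) ∘ γ ∘ V(α)⁻¹ : C(A) → C(B)` of `k`-algebras with involution, which is independent of the choice of `α`. … For any
positive integer `r`, `V(A^r) = rV(A)`, and the diagonal action of `C(A)` on `rV(A)` identifies `C(A)` with `C(A^r)` (as
`k`-algebras with involution)."; Prop. 1.1 (p. 643 L24–L28): "Any such isogeny induces an isomorphism `C(A₁) × ⋯ × C(A_s) → C(A)`
of `k`-algebras with involution, which is independent of the choice of the isogeny."  Also M. Green, P. Griffiths, M. Kerr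
[GreenGriffithsKerr2012] §V.B «Basic facts» (third bullet, p. 159: `V = V₁^{⊕m₁} ⊕ ⋯`), H. Lange [Lange2023AbelianVarietiesComplex]
§2.4.4 Cor. 2.4.26 (p. 124), D. Huybrechts [Huybrechts2016K3] §3.3.5 eq. (3.3) (the adjoint).

## Dictionary and what is proved (namespace `Literature.AlgebraicGeometry.Motives.HodgeStructure`)

`C(H) = Subalgebra.centralizer ℚ (H.endAlg : Set (Module.End ℚ V))`; `T : ι → SubHodgeStructure H'` an internal direct sum,
`rᵢ : H₀ → Tᵢ` bijective morphisms; `S`, `U` sub-Hodge structures of `H` with `U ≤ S`, `C(S)`, `C(U)` the centralizers of the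
induced Hodge structures; `†_Q` the adjoint of a polarization `Q`.

* §1 (the diagonal action) `centralizer_map_eq_of_forall_apply_hom_eq` (UNIQUENESS: two maps `C(H₀) → C(H')` acting diagonally,
  `(e γ₀)(rᵢ x) = rᵢ(γ₀ x)`, coincide — «independent of the choice»), **`exists_centralizer_endAlg_algEquiv_apply_hom_eq`**
  (EXISTENCE: `e : C(H₀) ≃ₐ[ℚ] C(H')` acting diagonally, and `e (γ₀^{†₀}) = (e γ₀)^{†'}` for ANY polarizations `ψ₀` of `H₀`, `ψ'`
  of `H'` — «as `k`-algebras with involution»), `Polarization.coe_map_adjoint_eq_adjoint_of_forall_apply_hom_eq` (ANY diagonal map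
  respects the involutions).
* §2 (polarizable `H`, sub-Hodge structures `U ≤ S`) **`coe_apply_mem_of_mem_centralizer_endAlg_of_coe_mem`** (`γ ∈ C(S)` preserves
  `U` — g53-#1 inside the polarizable Hodge structure `S`), `centralizer_map_eq_of_forall_coe_apply_eq_coe_apply` (two maps
  `C(S) → C(U)` over the restriction coincide), `Polarization.coe_map_restrict_adjoint_eq_of_forall_coe_apply_eq` (any map over the
  restriction carries `†_{ψ|S}` to `†_{ψ|U}`).
* §3 (a CANONICAL block: `S` minimal non-zero `E_φ`-stable, `U ⊆ S` irreducible) **`exists_centralizer_endAlg_algEquiv_coe_apply_eq_of_minimal_stable`**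
  (RESTRICTION TO `U` is an isomorphism `C(S) ≃ₐ[ℚ] C(U)`: injective because `S = ⨆{U' ≅ U}` and `γ` commutes with the morphisms
  `U ⥲ U' ↪ S`, surjective by the dimension count of g52-#5), **`Polarization.exists_centralizer_endAlg_algEquiv_coe_apply_eq_adjoint_of_minimal_stable`**
  (with involution: `(C(S), †_{ψ|S}) ≃ₐ (C(U), †_{ψ|U})`), `existsUnique_mem_centralizer_forall_coe_apply_eq_of_minimal_stable`
  (every `δ ∈ C(U)` is the restriction of a unique `γ ∈ C(S)`).
-/

noncomputable section

namespace Literature.AlgebraicGeometry.Motives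

namespace HodgeStructure

universe u

variable {n : ℤ}

/-! ## §1 «the diagonal action of `C(A)` on `rV(A)` identifies `C(A)` with `C(A^r)`» — the formula -/

section Diagonal

variable {V' : Type u} [AddCommGroup V'] [Module ℚ V'] [Module.Finite ℚ V'] {H' : HodgeStructure V' n}
  {W₀ : Type u} [AddCommGroup W₀] [Module ℚ W₀] [Module.Finite ℚ W₀] {H₀ : HodgeStructure W₀ n}
  {ι : Type} [Fintype ι] [DecidableEq ι] (T : ι → SubHodgeStructure H')
  (hT : DirectSum.IsInternal fun i => (T i).toSubmodule)
  (r : ∀ i, Hom H₀ (T i).toHodgeStructure) (hr : ∀ i, Function.Bijective (r i).toLinearMap)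

include hT hr

omit [Module.Finite ℚ V'] [Module.Finite ℚ W₀] in
/-- **«independent of the choice»: two maps `e, e' : C(H₀) → C(H')` acting DIAGONALLY along the isomorphisms `rᵢ : H₀ ⥲ Tᵢ` of an
internal direct sum `V' = ⊕ᵢ Tᵢ` — `(e γ₀)(rᵢ x) = rᵢ (γ₀ x)` — COINCIDE** (`V' = Σᵢ rᵢ(H₀)`).
[cite: Milne1999LefschetzClasses, §1 p. 643 L7–L13] -/
theorem centralizer_map_eq_of_forall_apply_hom_eq
    (e e' : Subalgebra.centralizer ℚ (H₀.endAlg : Set (Module.End ℚ W₀)) →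
      Subalgebra.centralizer ℚ (H'.endAlg : Set (Module.End ℚ V')))
    (he : ∀ (γ₀ : Subalgebra.centralizer ℚ (H₀.endAlg : Set (Module.End ℚ W₀))) (i : ι) (x : W₀),
      ((e γ₀ : Subalgebra.centralizer ℚ (H'.endAlg : Set (Module.End ℚ V'))) : Module.End ℚ V')
          (((r i).toLinearMap x : (T i).toSubmodule) : V') =
        (((r i).toLinearMap ((γ₀ : Module.End ℚ W₀) x) : (T i).toSubmodule) : V'))
    (he' : ∀ (γ₀ : Subalgebra.centralizer ℚ (H₀.endAlg : Set (Module.End ℚ W₀))) (i : ι) (x : W₀),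
      ((e' γ₀ : Subalgebra.centralizer ℚ (H'.endAlg : Set (Module.End ℚ V'))) : Module.End ℚ V')
          (((r i).toLinearMap x : (T i).toSubmodule) : V') =
        (((r i).toLinearMap ((γ₀ : Module.End ℚ W₀) x) : (T i).toSubmodule) : V')) :
    e = e' := by
  refine funext fun γ₀ => Subtype.ext (LinearMap.ext fun v => ?_)
  rw [← sum_isInternalProj_apply hT Finset.univ (fun j hj => absurd (Finset.mem_univ j) hj) v, map_sum, map_sum]
  refine Finset.sum_congr rfl fun i _ => ?_
  obtain ⟨x, hx⟩ := (hr i).2 ⟨isInternalProj hT i v, isInternalProj_apply_mem hT i v⟩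
  have hx' : isInternalProj hT i v = (((r i).toLinearMap x : (T i).toSubmodule) : V') := by rw [hx]
  rw [hx', he, he']

/-- **«the diagonal action of `C(A)` on `rV(A)` identifies `C(A)` with `C(A^r)` (as `k`-algebras with involution)», WITH ITS
FORMULA**: for an internal direct sum `V' = ⊕ᵢ Tᵢ` (`ι ≠ ∅`) of sub-Hodge structures with Hodge isomorphisms `rᵢ : H₀ ⥲ Tᵢ` there is
an isomorphism of `ℚ`-algebras `e : C(H₀) ≃ₐ[ℚ] C(H')` acting DIAGONALLY — `(e γ₀)(rᵢ x) = rᵢ (γ₀ x)`, i.e. `e γ₀ = rᵢ γ₀ rᵢ⁻¹` on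
each `Tᵢ` — and carrying the adjoint of ANY polarization `ψ₀` of `H₀` to the adjoint of ANY polarization `ψ'` of `H'`
(p34's `γ₀ ↦ diag(γ₀,…,γ₀)` followed by g52-#8's transport along `(xᵢ) ↦ Σ rᵢ xᵢ : H₀^{⊕ι} ⥲ H'`; `diag(γ₀)† = diag(γ₀†)`).
[cite: Milne1999LefschetzClasses, §1 p. 643 L7–L13 and Prop. 1.1] [cite: GreenGriffithsKerr2012, §V.B «Basic facts» (third bullet) (p. 159)] -/
theorem exists_centralizer_endAlg_algEquiv_apply_hom_eq [Nonempty ι] :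
    ∃ e : Subalgebra.centralizer ℚ (H₀.endAlg : Set (Module.End ℚ W₀)) ≃ₐ[ℚ]
        Subalgebra.centralizer ℚ (H'.endAlg : Set (Module.End ℚ V')),
      (∀ (γ₀ : Subalgebra.centralizer ℚ (H₀.endAlg : Set (Module.End ℚ W₀))) (i : ι) (x : W₀),
        ((e γ₀ : Subalgebra.centralizer ℚ (H'.endAlg : Set (Module.End ℚ V'))) : Module.End ℚ V')
            (((r i).toLinearMap x : (T i).toSubmodule) : V') =
          (((r i).toLinearMap ((γ₀ : Module.End ℚ W₀) x) : (T i).toSubmodule) : V')) ∧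
      ∀ (ψ₀ : Polarization H₀) (ψ' : Polarization H') (γ₀ : Subalgebra.centralizer ℚ (H₀.endAlg : Set (Module.End ℚ W₀))),
        ((e ⟨ψ₀.adjoint γ₀, ψ₀.adjoint_mem_centralizer_endAlg γ₀.2⟩ :
            Subalgebra.centralizer ℚ (H'.endAlg : Set (Module.End ℚ V'))) : Module.End ℚ V') =
          ψ'.adjoint ((e γ₀ : Subalgebra.centralizer ℚ (H'.endAlg : Set (Module.End ℚ V'))) : Module.End ℚ V') := by
  have hG := bijective_piDesc_subtypeHom_comp_toLinearMap T hT r hr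
  obtain ⟨e₁, he₁⟩ := exists_centralizer_endAlg_algEquiv_of_hom_bijective _ hG
  -- `(xⱼ) ↦ Σ rⱼ xⱼ` on a vector supported at `i`, and the diagonal on such a vector
  have hGs : ∀ (i : ι) (y : W₀), (Hom.piDesc (H := fun _ : ι => H₀) fun i => (T i).subtypeHom.comp (r i)).toLinearMap
      (Pi.single i y) = (((r i).toLinearMap y : (T i).toSubmodule) : V') := fun i y => by
    rw [Hom.piDesc_single, Hom.comp_toLinearMap, LinearMap.comp_apply, SubHodgeStructure.subtypeHom_toLinearMap,
      Submodule.subtype_apply]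
  have hdiag : ∀ (γ₀ : Subalgebra.centralizer ℚ (H₀.endAlg : Set (Module.End ℚ W₀))) (i : ι) (x : W₀),
      (piDiag fun _ : ι => (γ₀ : Module.End ℚ W₀)) (Pi.single i x) = Pi.single i ((γ₀ : Module.End ℚ W₀) x) :=
    fun γ₀ i x => by
    funext j
    rw [piDiag_apply]
    exact Pi.apply_single (fun _ => ⇑(γ₀ : Module.End ℚ W₀)) (fun _ => map_zero _) i x j
  refine ⟨(centralizerPiConstAlgEquiv (ι := ι) H₀).trans e₁, fun γ₀ i x => ?_, fun ψ₀ ψ' γ₀ => ?_⟩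
  · rw [AlgEquiv.trans_apply, ← hGs i x, he₁, coe_centralizerPiConstAlgEquiv_apply, hdiag, hGs]
  · rw [AlgEquiv.trans_apply, AlgEquiv.trans_apply]
    -- `diag(γ₀†) = diag(γ₀)†` for the product polarization, then g52-#8's transport of the adjoint along the isomorphism
    have h1 : centralizerPiConstAlgEquiv (ι := ι) H₀ ⟨ψ₀.adjoint γ₀, ψ₀.adjoint_mem_centralizer_endAlg γ₀.2⟩ =
        ⟨(Polarization.pi fun _ : ι => ψ₀).adjoint
            (centralizerPiConstAlgEquiv (ι := ι) H₀ γ₀ : Module.End ℚ (ι → W₀)),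
          (Polarization.pi fun _ : ι => ψ₀).adjoint_mem_centralizer_endAlg
            (centralizerPiConstAlgEquiv (ι := ι) H₀ γ₀).2⟩ := by
      apply Subtype.ext
      change (piDiag fun _ : ι => ψ₀.adjoint (γ₀ : Module.End ℚ W₀)) =
        (Polarization.pi fun _ : ι => ψ₀).adjoint (piDiag fun _ : ι => (γ₀ : Module.End ℚ W₀))
      rw [Polarization.adjoint_pi_piDiag]
    rw [h1]
    exact (Polarization.pi fun _ : ι => ψ₀).coe_map_adjoint_eq_adjoint_of_forall_apply_hom_apply _ hG ψ' e₁ he₁ _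

/-- **ANY diagonal map `C(H₀) → C(H')` respects the involutions** of arbitrary polarizations `ψ₀`, `ψ'` («as `k`-algebras with
involution»: by uniqueness it is the isomorphism of `exists_centralizer_endAlg_algEquiv_apply_hom_eq`).
[cite: Milne1999LefschetzClasses, §1 p. 643 L7–L13] [cite: Huybrechts2016K3, §3.3.5 eq. (3.3)] -/
theorem Polarization.coe_map_adjoint_eq_adjoint_of_forall_apply_hom_eq [Nonempty ι] (ψ₀ : Polarization H₀)
    (ψ' : Polarization H')
    (e : Subalgebra.centralizer ℚ (H₀.endAlg : Set (Module.End ℚ W₀)) →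
      Subalgebra.centralizer ℚ (H'.endAlg : Set (Module.End ℚ V')))
    (he : ∀ (γ₀ : Subalgebra.centralizer ℚ (H₀.endAlg : Set (Module.End ℚ W₀))) (i : ι) (x : W₀),
      ((e γ₀ : Subalgebra.centralizer ℚ (H'.endAlg : Set (Module.End ℚ V'))) : Module.End ℚ V')
          (((r i).toLinearMap x : (T i).toSubmodule) : V') =
        (((r i).toLinearMap ((γ₀ : Module.End ℚ W₀) x) : (T i).toSubmodule) : V'))
    (γ₀ : Subalgebra.centralizer ℚ (H₀.endAlg : Set (Module.End ℚ W₀))) :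
    ((e ⟨ψ₀.adjoint γ₀, ψ₀.adjoint_mem_centralizer_endAlg γ₀.2⟩ :
        Subalgebra.centralizer ℚ (H'.endAlg : Set (Module.End ℚ V'))) : Module.End ℚ V') =
      ψ'.adjoint ((e γ₀ : Subalgebra.centralizer ℚ (H'.endAlg : Set (Module.End ℚ V'))) : Module.End ℚ V') := by
  obtain ⟨e', he', hadj⟩ := exists_centralizer_endAlg_algEquiv_apply_hom_eq T hT r hr
  have h : e = e' := centralizer_map_eq_of_forall_apply_hom_eq T hT r hr e e' he he'
  rw [h]
  exact hadj ψ₀ ψ' γ₀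

end Diagonal

/-! ## §2 `γ ∈ C(S)` preserves every sub-Hodge structure `U ≤ S` (polarizable `H`); maps over the restriction -/

section Restriction

variable {V : Type u} [AddCommGroup V] [Module ℚ V] [Module.Finite ℚ V] {H : HodgeStructure V n}

omit [Module.Finite ℚ V] in
/-- Membership in the sub-Hodge structure `S ∩ U` of `S` read inside `S` (`SubHodgeStructure.comapSubtype`).
[cite: VoisinHodgeI2002, §7.3.1 Lemma 7.25] -/
theorem SubHodgeStructure.mem_comapSubtype_toSubmodule_iff (S U : SubHodgeStructure H) (s : S.toSubmodule) :
    s ∈ (S.comapSubtype U).toSubmodule ↔ (s : V) ∈ U.toSubmodule := by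
  rw [SubHodgeStructure.comapSubtype_toSubmodule, Submodule.mem_comap, Submodule.subtype_apply]

/-- **For a polarizable `H` and sub-Hodge structures `U`, `S`, every `γ ∈ C(S)` — the centralizer of `E_φ(S)` in `End(S)` —
maps `S ∩ U` into `U`** (g53-#1's `apply_mem_of_mem_centralizer_endAlg_of_isPolarizable` for the polarizable Hodge structure `S`
and its sub-Hodge structure `S ∩ U`). [cite: Milne1999LefschetzClasses, §1 p. 643] [cite: VoisinHodgeI2002, §7.3.1 Lemma 7.26] -/
theorem coe_apply_mem_of_mem_centralizer_endAlg_of_coe_mem (hH : H.IsPolarizable) (S U : SubHodgeStructure H)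
    {γ : Module.End ℚ S.toSubmodule}
    (hγ : γ ∈ Subalgebra.centralizer ℚ (S.toHodgeStructure.endAlg : Set (Module.End ℚ S.toSubmodule)))
    {s : S.toSubmodule} (hs : (s : V) ∈ U.toSubmodule) : ((γ s : S.toSubmodule) : V) ∈ U.toSubmodule := by
  obtain ⟨ψ⟩ := hH
  have hHS : S.toHodgeStructure.IsPolarizable := ⟨ψ.restrict S⟩
  have h := apply_mem_of_mem_centralizer_endAlg_of_isPolarizable hHS (S.comapSubtype U) hγ
    ((S.mem_comapSubtype_toSubmodule_iff U s).2 hs)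
  exact (S.mem_comapSubtype_toSubmodule_iff U _).1 h

variable {S U : SubHodgeStructure H} (hUS : U.toSubmodule ≤ S.toSubmodule)

include hUS

omit [Module.Finite ℚ V] in
/-- **Two maps `e, e' : C(S) → C(U)` lying over the restriction (`(e γ) u = γ u = (e' γ) u` in `V`) COINCIDE** («up to a canonical
isomorphism»). [cite: Milne1999LefschetzClasses, §1 p. 643 L9–L11] -/
theorem centralizer_map_eq_of_forall_coe_apply_eq_coe_apply
    (e e' : Subalgebra.centralizer ℚ (S.toHodgeStructure.endAlg : Set (Module.End ℚ S.toSubmodule)) →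
      Subalgebra.centralizer ℚ (U.toHodgeStructure.endAlg : Set (Module.End ℚ U.toSubmodule)))
    (he : ∀ (γ : Subalgebra.centralizer ℚ (S.toHodgeStructure.endAlg : Set (Module.End ℚ S.toSubmodule))) (u : U.toSubmodule),
      (((e γ : Subalgebra.centralizer ℚ (U.toHodgeStructure.endAlg : Set (Module.End ℚ U.toSubmodule))) :
          Module.End ℚ U.toSubmodule) u : V) = (((γ : Module.End ℚ S.toSubmodule) ⟨u, hUS u.2⟩ : S.toSubmodule) : V))
    (he' : ∀ (γ : Subalgebra.centralizer ℚ (S.toHodgeStructure.endAlg : Set (Module.End ℚ S.toSubmodule))) (u : U.toSubmodule),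
      (((e' γ : Subalgebra.centralizer ℚ (U.toHodgeStructure.endAlg : Set (Module.End ℚ U.toSubmodule))) :
          Module.End ℚ U.toSubmodule) u : V) = (((γ : Module.End ℚ S.toSubmodule) ⟨u, hUS u.2⟩ : S.toSubmodule) : V)) :
    e = e' :=
  funext fun γ => Subtype.ext (LinearMap.ext fun u => Subtype.ext ((he γ u).trans (he' γ u).symm))

/-- **ANY map `e : C(S) → C(U)` over the restriction carries the adjoint `†_{ψ|S}` to the adjoint `†_{ψ|U}`**:
`e (γ^{†_{ψ|S}}) = (e γ)^{†_{ψ|U}}` — `ψ|_U((e γ) u, u') = ψ(γ u, u') = ψ|_S(γ u, u') = ψ|_S(u, γ† u') = ψ|_U(u, (e γ†) u')` and adjoints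
for the non-degenerate `ψ|_U` are unique («as `k`-algebras with involution»).
[cite: Milne1999LefschetzClasses, §1 p. 643 L12–L13 and Prop. 1.1] [cite: Huybrechts2016K3, §3.3.5 eq. (3.3)] -/
theorem Polarization.coe_map_restrict_adjoint_eq_of_forall_coe_apply_eq (ψ : Polarization H)
    (e : Subalgebra.centralizer ℚ (S.toHodgeStructure.endAlg : Set (Module.End ℚ S.toSubmodule)) →
      Subalgebra.centralizer ℚ (U.toHodgeStructure.endAlg : Set (Module.End ℚ U.toSubmodule)))
    (he : ∀ (γ : Subalgebra.centralizer ℚ (S.toHodgeStructure.endAlg : Set (Module.End ℚ S.toSubmodule))) (u : U.toSubmodule),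
      (((e γ : Subalgebra.centralizer ℚ (U.toHodgeStructure.endAlg : Set (Module.End ℚ U.toSubmodule))) :
          Module.End ℚ U.toSubmodule) u : V) = (((γ : Module.End ℚ S.toSubmodule) ⟨u, hUS u.2⟩ : S.toSubmodule) : V))
    (γ : Subalgebra.centralizer ℚ (S.toHodgeStructure.endAlg : Set (Module.End ℚ S.toSubmodule))) :
    ((e ⟨(ψ.restrict S).adjoint γ, (ψ.restrict S).adjoint_mem_centralizer_endAlg γ.2⟩ :
        Subalgebra.centralizer ℚ (U.toHodgeStructure.endAlg : Set (Module.End ℚ U.toSubmodule))) : Module.End ℚ U.toSubmodule) =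
      (ψ.restrict U).adjoint ((e γ : Subalgebra.centralizer ℚ (U.toHodgeStructure.endAlg : Set (Module.End ℚ U.toSubmodule))) :
        Module.End ℚ U.toSubmodule) := by
  refine (ψ.restrict U).eq_adjoint_of_isAdjointPair fun u u' => ?_
  rw [ψ.restrict_form_apply, ψ.restrict_form_apply, he, he]
  have h := (ψ.restrict S).form_apply_adjoint (γ : Module.End ℚ S.toSubmodule) ⟨u, hUS u.2⟩ ⟨u', hUS u'.2⟩
  rw [ψ.restrict_form_apply, ψ.restrict_form_apply] at h
  exact h.symm

end Restriction

/-! ## §3 The canonical block: RESTRICTION TO `U` is an isomorphism `C(S) ≃ₐ[ℚ] C(U)` -/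

section CanonicalBlock

variable {V : Type u} [AddCommGroup V] [Module ℚ V] [Module.Finite ℚ V] {H : HodgeStructure V n}
  {S U : SubHodgeStructure H} (hUS : U.toSubmodule ≤ S.toSubmodule)

include hUS

/-- **The restriction `ρ : C(S) →ₐ[ℚ] C(U)`, `(ρ γ) u = γ u`, exists for ALL sub-Hodge structures `U ≤ S` of a polarizable `H`**:
`γ ∈ C(S)` preserves `U` (§2) and `γ|_U` commutes with every Hodge endomorphism `b` of `U` (g53-#1: `γ` commutes with the
morphism `S ∩ U ⥲ U →ᵇ U ↪ S` out of the sub-Hodge structure `S ∩ U` of the polarizable `S`).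
[cite: Milne1999LefschetzClasses, §1 p. 643 L12–L13] [cite: VoisinHodgeI2002, §7.3.1 Lemma 7.26] -/
theorem exists_algHom_centralizer_coe_apply_eq_of_le (hH : H.IsPolarizable) :
    ∃ ρ : Subalgebra.centralizer ℚ (S.toHodgeStructure.endAlg : Set (Module.End ℚ S.toSubmodule)) →ₐ[ℚ]
        Subalgebra.centralizer ℚ (U.toHodgeStructure.endAlg : Set (Module.End ℚ U.toSubmodule)),
      ∀ (γ : Subalgebra.centralizer ℚ (S.toHodgeStructure.endAlg : Set (Module.End ℚ S.toSubmodule))) (u : U.toSubmodule),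
        (((ρ γ : Subalgebra.centralizer ℚ (U.toHodgeStructure.endAlg : Set (Module.End ℚ U.toSubmodule))) :
            Module.End ℚ U.toSubmodule) u : V) = (((γ : Module.End ℚ S.toSubmodule) ⟨u, hUS u.2⟩ : S.toSubmodule) : V) := by
  have hHS : S.toHodgeStructure.IsPolarizable := by
    obtain ⟨ψ⟩ := hH
    exact ⟨ψ.restrict S⟩
  set A := S.comapSubtype U with hA
  -- the tautological isomorphism `τ : S ∩ U (inside S) ⥲ U` and the inclusion `U ↪ S` as a morphism
  let τ : Hom A.toHodgeStructure U.toHodgeStructure :=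
    (S.subtypeHom.comp A.subtypeHom).codRestrict U fun a => (S.mem_comapSubtype_toSubmodule_iff U _).1 a.2
  let j : Hom U.toHodgeStructure S.toHodgeStructure := U.subtypeHom.codRestrict S fun u => hUS u.2
  -- the restriction `γ|_U ∈ End(U)` of `γ ∈ C(S)`
  have hmem : ∀ (γ : Subalgebra.centralizer ℚ (S.toHodgeStructure.endAlg : Set (Module.End ℚ S.toSubmodule)))
      (u : U.toSubmodule), (S.toSubmodule.subtype ∘ₗ (γ : Module.End ℚ S.toSubmodule) ∘ₗ Submodule.inclusion hUS) u ∈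
        U.toSubmodule := fun γ u => coe_apply_mem_of_mem_centralizer_endAlg_of_coe_mem hH S U γ.2 u.2
  let res : Subalgebra.centralizer ℚ (S.toHodgeStructure.endAlg : Set (Module.End ℚ S.toSubmodule)) →
      Module.End ℚ U.toSubmodule := fun γ =>
    LinearMap.codRestrict U.toSubmodule (S.toSubmodule.subtype ∘ₗ (γ : Module.End ℚ S.toSubmodule) ∘ₗ
      Submodule.inclusion hUS) (hmem γ)
  have hres : ∀ (γ : Subalgebra.centralizer ℚ (S.toHodgeStructure.endAlg : Set (Module.End ℚ S.toSubmodule)))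
      (u : U.toSubmodule), ((res γ u : U.toSubmodule) : V) = (((γ : Module.End ℚ S.toSubmodule) ⟨u, hUS u.2⟩ : S.toSubmodule) : V) :=
    fun _ _ => rfl
  -- `γ|_U ∈ C(U)`
  have hresC : ∀ γ : Subalgebra.centralizer ℚ (S.toHodgeStructure.endAlg : Set (Module.End ℚ S.toSubmodule)),
      res γ ∈ Subalgebra.centralizer ℚ (U.toHodgeStructure.endAlg : Set (Module.End ℚ U.toSubmodule)) := fun γ => by
    rw [Subalgebra.mem_centralizer_iff]
    intro b hb
    refine LinearMap.ext fun u => Subtype.ext ?_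
    -- `γ` commutes with the morphism `f = j ∘ b ∘ τ : S ∩ U → S` (g53-#1), evaluated at the point `a` of `S ∩ U` over `u`
    let a : A.toSubmodule := ⟨⟨u, hUS u.2⟩, (S.mem_comapSubtype_toSubmodule_iff U _).2 u.2⟩
    have h := apply_hom_apply_eq_of_mem_centralizer_endAlg_of_isPolarizable hHS A γ.2
      (j.comp ((endAlg.toHom ⟨b, hb⟩).comp τ)) a
    have h' := congrArg (Subtype.val : S.toSubmodule → V) h
    exact h'.symm
  let ρr : Subalgebra.centralizer ℚ (S.toHodgeStructure.endAlg : Set (Module.End ℚ S.toSubmodule)) →+*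
      Subalgebra.centralizer ℚ (U.toHodgeStructure.endAlg : Set (Module.End ℚ U.toSubmodule)) :=
    { toFun := fun γ => ⟨res γ, hresC γ⟩
      map_one' := Subtype.ext (LinearMap.ext fun u => Subtype.ext rfl)
      map_mul' := fun _ _ => Subtype.ext (LinearMap.ext fun u => Subtype.ext rfl)
      map_zero' := Subtype.ext (LinearMap.ext fun u => Subtype.ext rfl)
      map_add' := fun _ _ => Subtype.ext (LinearMap.ext fun u => Subtype.ext rfl) }
  exact ⟨@RingHom.toRatAlgHom (Subalgebra.centralizer ℚ (S.toHodgeStructure.endAlg : Set (Module.End ℚ S.toSubmodule)))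
    (Subalgebra.centralizer ℚ (U.toHodgeStructure.endAlg : Set (Module.End ℚ U.toSubmodule))) _ _ _ _ ρr, hres⟩

variable (hS : (∀ a ∈ H.endAlg, ∀ v ∈ S.toSubmodule, a v ∈ S.toSubmodule) ∧ S.toSubmodule ≠ ⊥ ∧
    ∀ S' : SubHodgeStructure H, (∀ a ∈ H.endAlg, ∀ v ∈ S'.toSubmodule, a v ∈ S'.toSubmodule) →
      S'.toSubmodule ≤ S.toSubmodule → S'.toSubmodule = ⊥ ∨ S'.toSubmodule = S.toSubmodule)
  (hU : U.toHodgeStructure.IsIrreducible)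

include hS hU

/-- **On a canonical block, `γ ∈ C(S)` is determined by its restriction to `U`**: if `γ|_U = 0` then `γ = 0` — `S = ⨆ {U\' irreducible,
U\' ≅ U}` (g52-#1) and `γ` commutes with the morphisms `S ∩ U ⥲ U ⥲ U\' ↪ S` out of the sub-Hodge structure `S ∩ U` of the
polarizable `S` (g53-#1), so `γ|_{U\'} = 0` for all such `U\'`.
[cite: Milne1999LefschetzClasses, §1 p. 643 L12–L13 and Prop. 1.1] [cite: GreenGriffithsKerr2012, §V.B «Basic facts» (third bullet) (p. 159)] -/
theorem eq_zero_of_mem_centralizer_endAlg_of_forall_coe_apply_eq_zero (hH : H.IsPolarizable)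
    {γ : Module.End ℚ S.toSubmodule}
    (hγ : γ ∈ Subalgebra.centralizer ℚ (S.toHodgeStructure.endAlg : Set (Module.End ℚ S.toSubmodule)))
    (h0 : ∀ u : U.toSubmodule, ((γ ⟨u, hUS u.2⟩ : S.toSubmodule) : V) = 0) : γ = 0 := by
  have hHS : S.toHodgeStructure.IsPolarizable := by
    obtain ⟨ψ⟩ := hH
    exact ⟨ψ.restrict S⟩
  set A := S.comapSubtype U with hA
  let τ : Hom A.toHodgeStructure U.toHodgeStructure :=
    (S.subtypeHom.comp A.subtypeHom).codRestrict U fun a => (S.mem_comapSubtype_toSubmodule_iff U _).1 a.2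
  have hτ : ∀ a : A.toSubmodule, ((τ.toLinearMap a : U.toSubmodule) : V) = ((a : S.toSubmodule) : V) := fun _ => rfl
  -- `S = ⨆ {U\' irreducible ≅ U}`; `γ` kills each such `U\'`
  have hSsup := toSubmodule_eq_isotypicComponent_of_minimal_stable hH hS hU hUS
  have hker : ∀ U' : SubHodgeStructure H, (U'.toHodgeStructure.IsIrreducible ∧
      ∃ g : Hom U'.toHodgeStructure U.toHodgeStructure, Function.Bijective g.toLinearMap) →
        U'.toSubmodule ≤ (LinearMap.ker γ).map S.toSubmodule.subtype := by
    rintro U' ⟨hU', g, hg⟩ s hs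
    have hU'S : U'.toSubmodule ≤ S.toSubmodule := by
      rw [hSsup]
      exact le_iSup₂_of_le (f := fun (U' : SubHodgeStructure H) (_ : U'.toHodgeStructure.IsIrreducible ∧
        ∃ g : Hom U'.toHodgeStructure U.toHodgeStructure, Function.Bijective g.toLinearMap) => U'.toSubmodule)
        U' ⟨hU', g, hg⟩ le_rfl
    -- `f : S ∩ U ⥲ U ⥲ U\' ↪ S`, a morphism out of the sub-Hodge structure `S ∩ U` of the polarizable `S`
    let f : Hom A.toHodgeStructure S.toHodgeStructure :=
      (U'.subtypeHom.codRestrict S fun x => hU'S x.2).comp ((g.inverse hg).comp τ)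
    -- the point `a ∈ S ∩ U` over `g s ∈ U`; `f a = s` and `γ a = 0`
    let a : A.toSubmodule := ⟨⟨((g.toLinearMap ⟨s, hs⟩ : U.toSubmodule) : V), hUS (g.toLinearMap ⟨s, hs⟩).2⟩,
      (S.mem_comapSubtype_toSubmodule_iff U _).2 (g.toLinearMap ⟨s, hs⟩).2⟩
    have hτa : τ.toLinearMap a = g.toLinearMap ⟨s, hs⟩ := Subtype.ext (hτ a)
    have hfa : f.toLinearMap a = ⟨s, hU'S hs⟩ := by
      apply Subtype.ext
      change (((U'.subtypeHom.codRestrict S fun x => hU'S x.2).toLinearMap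
        ((g.inverse hg).toLinearMap (τ.toLinearMap a)) : S.toSubmodule) : V) = s
      rw [hτa, Hom.inverse_apply_apply, Hom.coe_codRestrict_apply, SubHodgeStructure.subtypeHom_toLinearMap,
        Submodule.subtype_apply]
    have hγa : γ (a : S.toSubmodule) = 0 := by
      rw [← Submodule.coe_eq_zero]
      exact h0 (g.toLinearMap ⟨s, hs⟩)
    have h := apply_hom_apply_eq_of_mem_centralizer_endAlg_of_isPolarizable hHS A hγ f a
    have hzero : (⟨γ (a : S.toSubmodule), apply_mem_of_mem_centralizer_endAlg_of_isPolarizable hHS A hγ a.2⟩ :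
        A.toSubmodule) = 0 := Subtype.ext hγa
    rw [hzero, map_zero, hfa] at h
    exact ⟨⟨s, hU'S hs⟩, LinearMap.mem_ker.2 h, rfl⟩
  have hle : S.toSubmodule ≤ (LinearMap.ker γ).map S.toSubmodule.subtype := by
    conv_lhs => rw [hSsup]
    exact iSup₂_le hker
  refine LinearMap.ext fun s => ?_
  obtain ⟨t, ht, hts⟩ := hle s.2
  have hts' : t = s := Subtype.ext hts
  rw [← hts', LinearMap.zero_apply]
  exact LinearMap.mem_ker.1 ht

/-- **THE CANONICAL BLOCK `C(S) ≃ₐ[ℚ] C(U)` BY RESTRICTION**: for a polarizable `H`, a minimal non-zero `E_φ`-stable sub-Hodge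
structure `S` and an irreducible `U ⊆ S`, `γ ↦ γ|_U` is an isomorphism of `ℚ`-algebras `e : C(S) ≃ₐ[ℚ] C(U)`, `(e γ) u = γ u`
(«identifies `C(A)` with `C(A^r)`» read on the canonical block `S ≅ U^{⊕m}` of the Hodge structure itself; injective by the
previous theorem, surjective by the dimension count of g52-#5's abstract isomorphism).
[cite: Milne1999LefschetzClasses, §1 p. 643 L12–L13 and Prop. 1.1] [cite: Lange2023AbelianVarietiesComplex, §2.4.4 Cor. 2.4.26 (p. 124)] -/
theorem exists_centralizer_endAlg_algEquiv_coe_apply_eq_of_minimal_stable (hH : H.IsPolarizable) :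
    ∃ e : Subalgebra.centralizer ℚ (S.toHodgeStructure.endAlg : Set (Module.End ℚ S.toSubmodule)) ≃ₐ[ℚ]
        Subalgebra.centralizer ℚ (U.toHodgeStructure.endAlg : Set (Module.End ℚ U.toSubmodule)),
      ∀ (γ : Subalgebra.centralizer ℚ (S.toHodgeStructure.endAlg : Set (Module.End ℚ S.toSubmodule))) (u : U.toSubmodule),
        (((e γ : Subalgebra.centralizer ℚ (U.toHodgeStructure.endAlg : Set (Module.End ℚ U.toSubmodule))) :
            Module.End ℚ U.toSubmodule) u : V) = (((γ : Module.End ℚ S.toSubmodule) ⟨u, hUS u.2⟩ : S.toSubmodule) : V) := by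
  obtain ⟨ρ, hρ⟩ := exists_algHom_centralizer_coe_apply_eq_of_le hUS hH
  have hinj : Function.Injective ρ := fun γ γ' h => by
    -- `γ - γ' ∈ C(S)` kills `U`, hence vanishes
    have h0 : ∀ u : U.toSubmodule, ((((γ : Module.End ℚ S.toSubmodule) - (γ' : Module.End ℚ S.toSubmodule))
        ⟨u, hUS u.2⟩ : S.toSubmodule) : V) = 0 := fun u => by
      rw [LinearMap.sub_apply, Submodule.coe_sub, ← hρ γ u, ← hρ γ' u, h, sub_self]
    have hsub := eq_zero_of_mem_centralizer_endAlg_of_forall_coe_apply_eq_zero hUS hS hU hH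
      (Subalgebra.sub_mem _ γ.2 γ'.2) h0
    exact Subtype.ext (sub_eq_zero.1 hsub)
  haveI : Module.Finite ℚ (Subalgebra.centralizer ℚ (S.toHodgeStructure.endAlg : Set (Module.End ℚ S.toSubmodule))) :=
    Module.Finite.of_injective (Subalgebra.val _).toLinearMap Subtype.val_injective
  haveI : Module.Finite ℚ (Subalgebra.centralizer ℚ (U.toHodgeStructure.endAlg : Set (Module.End ℚ U.toSubmodule))) :=
    Module.Finite.of_injective (Subalgebra.val _).toLinearMap Subtype.val_injective
  obtain ⟨e₀⟩ := nonempty_centralizer_endAlg_algEquiv_of_minimal_stable hH hS hU hUS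
  have hdim : Module.finrank ℚ (Subalgebra.centralizer ℚ (S.toHodgeStructure.endAlg : Set (Module.End ℚ S.toSubmodule))) =
      Module.finrank ℚ (Subalgebra.centralizer ℚ (U.toHodgeStructure.endAlg : Set (Module.End ℚ U.toSubmodule))) :=
    LinearEquiv.finrank_eq e₀.toLinearEquiv
  let ρL : Subalgebra.centralizer ℚ (S.toHodgeStructure.endAlg : Set (Module.End ℚ S.toSubmodule)) →ₗ[ℚ]
      Subalgebra.centralizer ℚ (U.toHodgeStructure.endAlg : Set (Module.End ℚ U.toSubmodule)) := ρ.toLinearMap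
  have key := @LinearMap.injective_iff_surjective_of_finrank_eq_finrank ℚ
    (Subalgebra.centralizer ℚ (S.toHodgeStructure.endAlg : Set (Module.End ℚ S.toSubmodule))) _ _ _
    (Subalgebra.centralizer ℚ (U.toHodgeStructure.endAlg : Set (Module.End ℚ U.toSubmodule))) _ _ _ _ hdim ρL
  exact ⟨AlgEquiv.ofBijective ρ ⟨hinj, key.1 hinj⟩, hρ⟩

/-- **THE CANONICAL BLOCK, «as `k`-algebras with involution»: `(C(S), †_{ψ|S}) ≃ₐ (C(U), †_{ψ|U})` by restriction** for every
polarization `ψ` of `H` (the restriction isomorphism of the previous theorem with §2's compatibility of the adjoints).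
[cite: Milne1999LefschetzClasses, §1 p. 643 L12–L13 and Prop. 1.1] [cite: Huybrechts2016K3, §3.3.5 eq. (3.3)] -/
theorem Polarization.exists_centralizer_endAlg_algEquiv_coe_apply_eq_adjoint_of_minimal_stable (ψ : Polarization H) :
    ∃ e : Subalgebra.centralizer ℚ (S.toHodgeStructure.endAlg : Set (Module.End ℚ S.toSubmodule)) ≃ₐ[ℚ]
        Subalgebra.centralizer ℚ (U.toHodgeStructure.endAlg : Set (Module.End ℚ U.toSubmodule)),
      (∀ (γ : Subalgebra.centralizer ℚ (S.toHodgeStructure.endAlg : Set (Module.End ℚ S.toSubmodule))) (u : U.toSubmodule),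
        (((e γ : Subalgebra.centralizer ℚ (U.toHodgeStructure.endAlg : Set (Module.End ℚ U.toSubmodule))) :
            Module.End ℚ U.toSubmodule) u : V) = (((γ : Module.End ℚ S.toSubmodule) ⟨u, hUS u.2⟩ : S.toSubmodule) : V)) ∧
      ∀ γ : Subalgebra.centralizer ℚ (S.toHodgeStructure.endAlg : Set (Module.End ℚ S.toSubmodule)),
        ((e ⟨(ψ.restrict S).adjoint γ, (ψ.restrict S).adjoint_mem_centralizer_endAlg γ.2⟩ :
            Subalgebra.centralizer ℚ (U.toHodgeStructure.endAlg : Set (Module.End ℚ U.toSubmodule))) :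
              Module.End ℚ U.toSubmodule) =
          (ψ.restrict U).adjoint ((e γ : Subalgebra.centralizer ℚ (U.toHodgeStructure.endAlg :
            Set (Module.End ℚ U.toSubmodule))) : Module.End ℚ U.toSubmodule) := by
  obtain ⟨e, he⟩ := exists_centralizer_endAlg_algEquiv_coe_apply_eq_of_minimal_stable hUS hS hU ⟨ψ⟩
  exact ⟨e, he, fun γ => ψ.coe_map_restrict_adjoint_eq_of_forall_coe_apply_eq hUS e he γ⟩

/-- **Every `δ ∈ C(U)` is the restriction of a UNIQUE `γ ∈ C(S)`** (bijectivity of restriction on the canonical block, spelled out):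
on `S ≅ U^{⊕m}` the elements of Milne's centralizer are exactly the diagonal extensions of the elements of `C(U)`.
[cite: Milne1999LefschetzClasses, §1 p. 643 L12–L13 and Prop. 1.1] -/
theorem existsUnique_mem_centralizer_forall_coe_apply_eq_of_minimal_stable (hH : H.IsPolarizable)
    (δ : Subalgebra.centralizer ℚ (U.toHodgeStructure.endAlg : Set (Module.End ℚ U.toSubmodule))) :
    ∃! γ : Module.End ℚ S.toSubmodule,
      γ ∈ Subalgebra.centralizer ℚ (S.toHodgeStructure.endAlg : Set (Module.End ℚ S.toSubmodule)) ∧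
        ∀ u : U.toSubmodule, ((γ ⟨u, hUS u.2⟩ : S.toSubmodule) : V) = (((δ : Module.End ℚ U.toSubmodule) u : U.toSubmodule) : V) := by
  obtain ⟨e, he⟩ := exists_centralizer_endAlg_algEquiv_coe_apply_eq_of_minimal_stable hUS hS hU hH
  refine ⟨(e.symm δ : Subalgebra.centralizer ℚ (S.toHodgeStructure.endAlg : Set (Module.End ℚ S.toSubmodule))),
    ⟨(e.symm δ).2, fun u => ?_⟩, fun γ' hγ' => ?_⟩
  · rw [← he (e.symm δ) u, AlgEquiv.apply_symm_apply]
  · obtain ⟨hγ'C, hγ'⟩ := hγ'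
    have h : e ⟨γ', hγ'C⟩ = δ :=
      Subtype.ext (LinearMap.ext fun u => Subtype.ext ((he ⟨γ', hγ'C⟩ u).trans (hγ' u)))
    have h' : (⟨γ', hγ'C⟩ : Subalgebra.centralizer ℚ (S.toHodgeStructure.endAlg : Set (Module.End ℚ S.toSubmodule))) =
        e.symm δ := by
      rw [← h, AlgEquiv.symm_apply_apply]
    exact congrArg Subtype.val h'

end CanonicalBlock

end HodgeStructure

end Literature.AlgebraicGeometry.Motives
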